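import Literature.NumberTheory.Transcendental.NesterenkoMultiplicityHeights
import Literature.NumberTheory.Transcendental.NesterenkoEliminationProp44K
import Mathlib.Analysis.Complex.Polynomial.Basic
import HarnessLib

/-!
# Heights over `K = ℂ(z)`: Gauss's lemma, additivity, and LNM 1752 Ch. 3 Prop. 4.7 2) — proofs only

`Literature/NumberTheory/Transcendental/NesterenkoMultiplicityHeightsGauss.lean` — proofs only (no
definitions, no named facts), on top of `NesterenkoMultiplicityHeights.lean` (`fheight`, `heightI`):

* `coeffDeg_mul` — `deg_z (E₁E₂) = deg_z E₁ + deg_z E₂` in `ℂ[z][X_σ]` (the `z`-top slices multiply to a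
  non-zero polynomial of `ℂ[X_σ]`);
* `isUnit_content_mul` — **Gauss's lemma**: unit content is preserved under products (a common root `a` of
  the coefficients of `E₁E₂` kills `E₁(a)E₂(a)` in the domain `ℂ[X_σ]`);
* `fheight_mul`, `fheight_pow`, `fheight_prod`, `fheight_one` — **`h(FG) = h(F) + h(G)`** on `K[X_σ] ∖ 0`;
* **`prop_4_7_height_heightI`** — the field `prop_4_7_height` of the Ch. 10 hypothesis bundle `CzToolkit`
  (`NesterenkoMultiplicityToolkit.lean`) for the heights `heightI`: for a homogeneous unmixed `I` of rank `r`
  with reduced primary decomposition `t`, `∑_{Q ∈ t} k_Q h(√Q) = h(I)` (LNM 1752 Ch. 3 Prop. 4.7 2) with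
  `𝓜_∞ = ∅`), from `NesterenkoK.exists_chowForm_eq_C_mul_prod` (`F_I = c ∏ F_{√Q}^{k_Q}`).

## References

* [NesterenkoPhilippon2001] Yu. V. Nesterenko, P. Philippon (eds.), *Introduction to Algebraic
  Independence Theory*, LNM 1752, Springer 2001, Ch. 3 Prop. 4.4, Prop. 4.7 2) (pp. 38–39); Ch. 10 §2 (p. 152).
-/

noncomputable section

open MvPolynomial
open scoped Polynomial

namespace Literature.NumberTheory.Transcendental

namespace NesterenkoMultiplicity

/-! ## Gauss's lemma for `ℂ[z][X_σ]` and additivity of the height -/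

section Gauss

variable {σ : Type*}

/-- `deg_z (E₁ E₂) ≤ deg_z E₁ + deg_z E₂`. [folklore] -/
theorem coeffDeg_mul_le (E₁ E₂ : MvPolynomial σ ℂ[X]) : coeffDeg (E₁ * E₂) ≤ coeffDeg E₁ + coeffDeg E₂ := by
  classical
  refine coeffDeg_le_of_forall fun e _ => ?_
  rw [coeff_mul]
  apply Polynomial.natDegree_sum_le_of_forall_le
  intro x _
  exact Polynomial.natDegree_mul_le.trans
    (add_le_add (natDegree_coeff_le_coeffDeg _ _) (natDegree_coeff_le_coeffDeg _ _))

/-- The coefficient of `z^{d₁+d₂} X^e` in `E₁ E₂` (`dᵢ = deg_z Eᵢ`) is the coefficient of `X^e` in the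
product of the `z`-top slices. [folklore] -/
theorem coeff_coeff_mul_coeffDeg (E₁ E₂ : MvPolynomial σ ℂ[X]) (e : σ →₀ ℕ) :
    ((E₁ * E₂).coeff e).coeff (coeffDeg E₁ + coeffDeg E₂) =
      ((∑ e ∈ E₁.support, monomial e ((E₁.coeff e).coeff (coeffDeg E₁))) *
        (∑ e ∈ E₂.support, monomial e ((E₂.coeff e).coeff (coeffDeg E₂)))).coeff e := by
  classical
  have hslice : ∀ (E : MvPolynomial σ ℂ[X]) (d : ℕ) (e' : σ →₀ ℕ),
      (∑ e ∈ E.support, monomial e ((E.coeff e).coeff d) : MvPolynomial σ ℂ).coeff e' = (E.coeff e').coeff d := by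
    intro E d e'
    rw [coeff_sum]
    simp only [coeff_monomial, Finset.sum_ite_eq', mem_support_iff, ne_eq, ite_not]
    split_ifs with h
    · rw [h, Polynomial.coeff_zero]
    · rfl
  rw [coeff_mul, coeff_mul, Polynomial.finsetSum_coeff]
  refine Finset.sum_congr rfl fun x _ => ?_
  rw [hslice, hslice]
  exact Polynomial.coeff_mul_add_eq_of_natDegree_le (natDegree_coeff_le_coeffDeg _ _) (natDegree_coeff_le_coeffDeg _ _)

/-- The `z`-top slice of a non-zero `E` is non-zero. [folklore] -/
theorem slice_coeffDeg_ne_zero {E : MvPolynomial σ ℂ[X]} (hE : E ≠ 0) :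
    (∑ e ∈ E.support, monomial e ((E.coeff e).coeff (coeffDeg E)) : MvPolynomial σ ℂ) ≠ 0 := by
  classical
  have hne : E.support.Nonempty := support_nonempty.mpr hE
  obtain ⟨e₀, he₀, hmax⟩ := E.support.exists_max_image (fun e => (E.coeff e).natDegree) hne
  have hdeg : coeffDeg E = (E.coeff e₀).natDegree :=
    le_antisymm (Finset.sup_le hmax) (natDegree_coeff_le_coeffDeg E e₀)
  intro h
  have h1 := congrArg (coeff e₀) h
  rw [coeff_sum, coeff_zero] at h1
  simp only [coeff_monomial, Finset.sum_ite_eq', he₀, if_true] at h1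
  rw [hdeg, Polynomial.coeff_natDegree, Polynomial.leadingCoeff_eq_zero] at h1
  exact (mem_support_iff.mp he₀) h1

/-- **`deg_z (E₁ E₂) = deg_z E₁ + deg_z E₂`** for non-zero `E₁, E₂ ∈ ℂ[z][X_σ]` (`ℂ[z][X_σ] = ℂ[X_σ][z]` is
a domain). [folklore] -/
theorem coeffDeg_mul {E₁ E₂ : MvPolynomial σ ℂ[X]} (h₁ : E₁ ≠ 0) (h₂ : E₂ ≠ 0) :
    coeffDeg (E₁ * E₂) = coeffDeg E₁ + coeffDeg E₂ := by
  classical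
  refine le_antisymm (coeffDeg_mul_le E₁ E₂) ?_
  have hprod := mul_ne_zero (slice_coeffDeg_ne_zero h₁) (slice_coeffDeg_ne_zero h₂)
  obtain ⟨e, he⟩ := ne_zero_iff.mp hprod
  rw [← coeff_coeff_mul_coeffDeg] at he
  exact (Polynomial.le_natDegree_of_ne_zero he).trans (natDegree_coeff_le_coeffDeg _ _)

/-- If all coefficients of `E` vanish at `a ∈ ℂ`, then `z − a` divides the content of `E`. [folklore] -/
theorem X_sub_C_dvd_content_of_forall_eval_eq_zero {E : MvPolynomial σ ℂ[X]} {a : ℂ}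
    (h : ∀ e, (E.coeff e).eval a = 0) : (Polynomial.X - Polynomial.C a) ∣ content E :=
  Finset.dvd_gcd fun e _ => (Polynomial.dvd_iff_isRoot).mpr (h e)

/-- `E ↦ E(a)`: reduction of the coefficients modulo `z − a`. If the reduction of `E` vanishes then all
coefficients vanish at `a`. [folklore] -/
theorem forall_eval_eq_zero_of_map_eq_zero {E : MvPolynomial σ ℂ[X]} {a : ℂ}
    (h : MvPolynomial.map (Polynomial.evalRingHom a) E = 0) (e : σ →₀ ℕ) : (E.coeff e).eval a = 0 := by
  have := congrArg (coeff e) h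
  rwa [coeff_map, coeff_zero] at this

/-- **Gauss's lemma in `ℂ[z][X_σ]`**: the product of two polynomials with unit content has unit content.
[folklore] -/
theorem isUnit_content_mul {E₁ E₂ : MvPolynomial σ ℂ[X]} (h₁ : IsUnit (content E₁)) (h₂ : IsUnit (content E₂)) :
    IsUnit (content (E₁ * E₂)) := by
  classical
  have hE₁ : E₁ ≠ 0 := fun h => by rw [h, (content_eq_zero_iff _).mpr rfl] at h₁; exact not_isUnit_zero h₁
  have hE₂ : E₂ ≠ 0 := fun h => by rw [h, (content_eq_zero_iff _).mpr rfl] at h₂; exact not_isUnit_zero h₂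
  by_contra hnu
  set g := content (E₁ * E₂) with hg
  have hg0 : g ≠ 0 := fun h => mul_ne_zero hE₁ hE₂ ((content_eq_zero_iff _).mp h)
  -- a root `a` of the non-unit `g`
  obtain ⟨a, ha⟩ := Complex.exists_root (Polynomial.degree_pos_of_ne_zero_of_nonunit hg0 hnu)
  have hvan : ∀ e, ((E₁ * E₂).coeff e).eval a = 0 := fun e =>
    Polynomial.eval_eq_zero_of_dvd_of_eval_eq_zero (content_dvd_coeff _ e) ha
  have hmap : MvPolynomial.map (Polynomial.evalRingHom a) (E₁ * E₂) = 0 := by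
    ext e; rw [coeff_map, coeff_zero]; exact hvan e
  rw [map_mul, mul_eq_zero] at hmap
  rcases hmap with h | h
  · exact Polynomial.not_isUnit_X_sub_C a
      (isUnit_of_dvd_unit (X_sub_C_dvd_content_of_forall_eval_eq_zero (forall_eval_eq_zero_of_map_eq_zero h)) h₁)
  · exact Polynomial.not_isUnit_X_sub_C a
      (isUnit_of_dvd_unit (X_sub_C_dvd_content_of_forall_eval_eq_zero (forall_eval_eq_zero_of_map_eq_zero h)) h₂)

/-- The primitive part of a non-zero `E` has content `1`. [folklore] -/
theorem content_primPart {E : MvPolynomial σ ℂ[X]} (hE : E ≠ 0) : content (primPart E) = 1 := by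
  have hc : content E ≠ 0 := fun h => hE ((content_eq_zero_iff E).mp h)
  have h := congrArg content (content_smul_primPart E)
  rw [content_smul hc, show normalize (content E) = content E from Finset.normalize_gcd] at h
  conv_rhs at h => rw [← mul_one (content E)]
  exact mul_left_cancel₀ hc h

/-- `primPart E ≠ 0` for `E ≠ 0`. [folklore] -/
theorem primPart_ne_zero {E : MvPolynomial σ ℂ[X]} (hE : E ≠ 0) : primPart E ≠ 0 :=
  fun h => hE ((primPart_eq_zero_iff E).mp h)

/-- A polynomial with unit content is its own primitive part up to a unit: `primPart Q = u⁻¹ Q`. [folklore] -/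
theorem primPart_eq_C_mul_of_content_eq {Q : MvPolynomial σ ℂ[X]} {u : ℂ[X]ˣ} (hu : content Q = ↑u) :
    primPart Q = C (↑u⁻¹ : ℂ[X]) * Q := by
  ext e
  rw [coeff_primPart, coeff_C_mul, hu]
  conv_lhs => rw [show Q.coeff e = (↑u : ℂ[X]) * (↑u⁻¹ * Q.coeff e) by
    rw [← mul_assoc, Units.mul_inv, one_mul]]
  rw [mul_div_cancel_left₀ _ (Units.ne_zero u)]

/-- `deg_z (primPart Q) = deg_z Q` when `Q` has unit content. [folklore] -/
theorem coeffDeg_primPart_of_isUnit_content {Q : MvPolynomial σ ℂ[X]} (hQ : IsUnit (content Q)) :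
    coeffDeg (primPart Q) = coeffDeg Q := by
  obtain ⟨u, hu⟩ := hQ
  rw [primPart_eq_C_mul_of_content_eq hu.symm, coeffDeg_C_mul_of_isUnit (Units.isUnit _)]

/-- An integral representative of a non-zero `F` is non-zero. [folklore] -/
theorem ne_zero_of_map_eq {F : MvPolynomial σ (RatFunc ℂ)} (hF : F ≠ 0) {c : ℂ[X]} (hc : c ≠ 0)
    {E : MvPolynomial σ ℂ[X]}
    (h : MvPolynomial.map (algebraMap ℂ[X] (RatFunc ℂ)) E = C (algebraMap ℂ[X] (RatFunc ℂ) c) * F) : E ≠ 0 := by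
  rintro rfl
  rw [map_zero, eq_comm, mul_eq_zero, C_eq_zero] at h
  rcases h with h | h
  · exact hc ((map_eq_zero_iff _ (IsFractionRing.injective ℂ[X] (RatFunc ℂ))).mp h)
  · exact hF h

/-- **The height is additive: `h(FG) = h(F) + h(G)`** for non-zero `F, G ∈ K[X_σ]`, `K = ℂ(z)` (Gauss's lemma).
[cite: NesterenkoPhilippon2001, Ch. 3 §4, proof of Prop. 4.7 2) (p. 39)] -/
theorem fheight_mul {F G : MvPolynomial σ (RatFunc ℂ)} (hF : F ≠ 0) (hG : G ≠ 0) :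
    fheight (F * G) = fheight F + fheight G := by
  obtain ⟨c, hc, E, hE⟩ := exists_integral_rep F
  obtain ⟨c', hc', E', hE'⟩ := exists_integral_rep G
  have hE0 : E ≠ 0 := ne_zero_of_map_eq hF hc hE
  have hE'0 : E' ≠ 0 := ne_zero_of_map_eq hG hc' hE'
  have hrep : MvPolynomial.map (algebraMap ℂ[X] (RatFunc ℂ)) (E * E') =
      C (algebraMap ℂ[X] (RatFunc ℂ) (c * c')) * (F * G) := by
    rw [map_mul, hE, hE', map_mul (algebraMap ℂ[X] (RatFunc ℂ)), map_mul C]; ring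
  rw [fheight_eq_of_map_eq (mul_ne_zero hc hc') hrep, fheight_eq_of_map_eq hc hE, fheight_eq_of_map_eq hc' hE']
  have hcE : content E ≠ 0 := fun h => hE0 ((content_eq_zero_iff E).mp h)
  have hcE' : content E' ≠ 0 := fun h => hE'0 ((content_eq_zero_iff E').mp h)
  have hEE' : E * E' = (content E * content E') • (primPart E * primPart E') := by
    conv_lhs => rw [← content_smul_primPart E, ← content_smul_primPart E']
    rw [smul_mul_smul_comm]
  rw [hEE', coeffDeg_primPart_smul (mul_ne_zero hcE hcE'),
    coeffDeg_primPart_of_isUnit_content (isUnit_content_mul (by rw [content_primPart hE0]; exact isUnit_one)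
      (by rw [content_primPart hE'0]; exact isUnit_one)),
    coeffDeg_mul (primPart_ne_zero hE0) (primPart_ne_zero hE'0)]

/-- `h(1) = 0`. [folklore] -/
theorem fheight_one : fheight (1 : MvPolynomial σ (RatFunc ℂ)) = 0 := by
  classical
  have h := fheight_le_coeffDeg_of_map_eq one_ne_zero (E := (1 : MvPolynomial σ ℂ[X])) (F := 1)
    (by rw [map_one, map_one, C_1, one_mul])
  have h1 : coeffDeg (1 : MvPolynomial σ ℂ[X]) = 0 := by
    refine Nat.eq_zero_of_le_zero (coeffDeg_le_of_forall fun e _ => ?_)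
    rw [← C_1, coeff_C]
    split_ifs <;> simp
  omega

/-- `h(Fⁿ) = n h(F)`. [folklore] -/
theorem fheight_pow {F : MvPolynomial σ (RatFunc ℂ)} (hF : F ≠ 0) (n : ℕ) : fheight (F ^ n) = n * fheight F := by
  induction n with
  | zero => rw [pow_zero, fheight_one, zero_mul]
  | succ n ih => rw [pow_succ, fheight_mul (pow_ne_zero _ hF) hF, ih]; ring

/-- `h(∏ Fᵢ) = ∑ h(Fᵢ)` for non-zero factors. [folklore] -/
theorem fheight_prod {ι : Type*} (s : Finset ι) (f : ι → MvPolynomial σ (RatFunc ℂ)) (hf : ∀ i ∈ s, f i ≠ 0) :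
    fheight (∏ i ∈ s, f i) = ∑ i ∈ s, fheight (f i) := by
  classical
  induction s using Finset.induction_on with
  | empty => simp [fheight_one]
  | insert a s ha ih =>
    rw [Finset.prod_insert ha, Finset.sum_insert ha,
      fheight_mul (hf a (Finset.mem_insert_self a s))
        (Finset.prod_ne_zero_iff.mpr fun i hi => hf i (Finset.mem_insert_of_mem hi)),
      ih fun i hi => hf i (Finset.mem_insert_of_mem hi)]

end Gauss

/-! ## Ch. 3 Proposition 4.7 2) over `K = ℂ(z)`: `h(I) = ∑ k_j h(𝔭_j)` -/

section Prop47

variable {m : ℕ}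

attribute [local instance] MvPolynomial.gradedAlgebra

open NesterenkoK in
/-- **LNM 1752 Ch. 3 Prop. 4.7 2) over `K = ℂ(z)`** (all places of `ℂ(z)` are non-archimedean, `𝓜_∞ = ∅`,
so equality holds): for a homogeneous unmixed `I` of rank `r` with reduced primary decomposition `t`,
`∑_{Q ∈ t} k_Q h(√Q) = h(I)` — the toolkit field `CzToolkit.prop_4_7_height` for the heights `heightI`.
Proof: `F_I = c ∏ F_{√Q}^{k_Q}` (`NesterenkoK.exists_chowForm_eq_C_mul_prod`) and the height is invariant
under `K^×` and additive (Gauss's lemma). [cite: NesterenkoPhilippon2001, Ch. 3 Prop. 4.7 2) (p. 39); Ch. 10 §2 (p. 152)] -/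
theorem prop_4_7_height_heightI (m : ℕ) :
    ∀ (r : ℕ) (I : Ideal (Kx m)) (t : Finset (Ideal (Kx m))), 1 ≤ r → r ≤ m →
      I.IsHomogeneous (homogeneousSubmodule (Fin (m + 1)) (RatFunc ℂ)) → IsUnmixedOfRank I r →
      Submodule.IsMinimalPrimaryDecomposition I t →
        ∑ Q ∈ t, (primaryExponent Q : ℝ) * heightI Q.radical r = heightI I r := by
  intro r I t hr1 hrm hIh hI ht
  obtain ⟨hne, c, hc, hprod⟩ := exists_chowForm_eq_C_mul_prod hr1 hrm hIh hI ht
  unfold heightI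
  rw [hprod, fheight_C_mul hc, fheight_prod _ _ (fun Q hQ => pow_ne_zero _ (hne Q hQ))]
  push_cast
  refine Finset.sum_congr rfl fun Q hQ => ?_
  rw [fheight_pow (hne Q hQ)]
  push_cast; ring

end Prop47



end NesterenkoMultiplicity

end Literature.NumberTheory.Transcendental

end
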